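import Summits.CriticalPhenomena.PercolationContinuityZ3.Theorems.Transplant.FKConnectivityAllQForestTriangleGluing
import Summits.CriticalPhenomena.PercolationContinuityZ3.Theorems.Transplant.FKConnectivityAllQForestAdjacentEdgeSeparator
import HarnessLib

/-!
# The square-free adjacent forest node is an EQUALITY across a triangle separator

builds on p205010 (kernel theorem, internal audit signed; external expert review pending).  No definitions, no named facts, no sorries;
standard axioms.

The case `|S| = 3` of the dense-separator equality theorem (memo bschramm/FROM-fk-1-g19-ADVERSARIAL.md §2f): if a TRIANGLE
`S = {o, p, q}` of the fibre (`op, oq, pq` all among the fibre's pairs) separates `v` from `y`, then for the fibre counts of the node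
`FK.AdjForestRayleighNoSqOn` one has `#(Fo ∩ {e, f ∈ ω}, Fo) = #(Fo ∩ {e ∈ ω}, Fo ∩ {f ∈ ω})` (`e = ov`, `f = oy`), i.e.
`P(e, f same colour) = 1/2` EXACTLY.  This is the mechanism behind every "primitive" equality of the node found by the g18/g19 mining
(the three-triangle graph on 9 vertices, the 10-vertex graphs, g18's 12-vertex §4d example), none of which has a cut vertex, a 2-separation
or a tight set.

Set-up: sides `E₁` (pairs on `V₁`), `E₂` (pairs on `V₂`), `V₁ ∩ V₂ ⊆ S`, the gadget `ES = {op, oq, pq}`, the three pairwise disjoint; the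
fibre `(M', u₀)` has its pairs in `ES ∪ E₁ ∪ E₂` and contains `ES`; `e ∈ E₁`, `f ∈ E₂`.  A side configuration `Z` is `S`-WIRED if it is a
forest joining no two points of `S`.
* `triangle_gadget` (the GADGET LEMMA of the memo for the triangle): for a valid colouring (`ω`, `ω ∆ M'` forests), if one of the two
  side-2 classes is not `S`-wired then both side-1 classes are (`…ForestTriangleGluing`: two gadget pairs in a class wire both its sides,
  one gadget pair wires one of them, zero is impossible).
* `forest_pair_transfer_of_triangleSep`: the explicit involution `Φ` — recolour side 2 by its partner if both side-2 classes are
  `S`-wired, recolour side 2 AND the gadget otherwise; validity by `isForestCfg_union_of_sep` (a wired side glues freely onto any forest).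
* **`adjForestNoSq_fibre_eq_of_triangleSep`**: the equality of the fibre counts.
[cite: Grimmett2006, §1.5 (p. 13); §3.8 (pp. 61–62)] [cite: SempleWelsh2008, Conj. 1.1 (p. 2)] [cite: Linusson2011, Prop. 2.6]
-/

noncomputable section

namespace Summit.CriticalPhenomena.PercolationContinuityZ3.Theorems

namespace FK

open Set Literature.Probability.LatticeModels Literature.Probability.Percolation
open scoped Classical symmDiff

variable {V : Type*} [Fintype V]

section TriangleSep

variable {E₁ E₂ ES : Set (Sym2 V)} {V₁ V₂ : Set V} {M u₀ : BondConfig V} {o p q v y : V}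

omit [Fintype V] in
/-- Relabelling the triangle: `{p, o, q} = {o, p, q}`, `{q, o, p} = {o, p, q}`, `{o, q, p} = {o, p, q}`, `{p, q, o} = {o, p, q}`. [folklore] -/
theorem triple_perm (o p q : V) :
    ({p, o, q} : Set V) = {o, p, q} ∧ ({q, o, p} : Set V) = {o, p, q} ∧ ({o, q, p} : Set V) = {o, p, q} ∧
      ({p, q, o} : Set V) = {o, p, q} := by
  refine ⟨insert_comm p o {q}, ?_, ?_, ?_⟩
  · rw [insert_comm q o, pair_comm q p]
  · rw [pair_comm q p]
  · rw [pair_comm q o, insert_comm p o, pair_comm p q]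

omit [Fintype V] in
/-- Two gadget pairs `ab, ac` in a forest `X` wire the part of `X` inside any `E ∌ ab, ac`. [cite: Grimmett2006, §1.5 (p. 13)] -/
theorem sep_inter_of_two_pairs {X E : BondConfig V} {a b c : V} (hab : a ≠ b) (hac : a ≠ c) (hbc : b ≠ c) (hX : IsForestCfg X)
    (h1 : s(a, b) ∈ X) (h2 : s(a, c) ∈ X) (hE1 : s(a, b) ∉ E) (hE2 : s(a, c) ∉ E) :
    ∀ x ∈ ({a, b, c} : Set V), ∀ y' ∈ ({a, b, c} : Set V), (openGraph (X ∩ E)).Reachable x y' → x = y' := by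
  have hsub : ({s(a, b), s(a, c)} : Set (Sym2 V)) ∪ X ∩ E ⊆ X := by
    refine union_subset ?_ inter_subset_left
    intro g hg
    rcases mem_insert_iff.1 hg with rfl | hg
    · exact h1
    · rw [mem_singleton_iff.1 hg]; exact h2
  exact ((isForestCfg_pairPath_union_iff hab hac hbc (fun h => hE1 h.2) (fun h => hE2 h.2)).1
    (isForestCfg_of_subset hX hsub)).2

/-- **The gadget lemma for the triangle** (memo §2f(ii), `|S| = 3`).  For a valid colouring `(X, Y)` (both forests) in which every
gadget pair lies in `X` or in `Y`: if the side-2 part of `X` is not `S`-wired, then the side-1 parts of `X` and of `Y` and the side-2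
part of `Y` are `S`-wired. [cite: Grimmett2006, §1.5 (p. 13); §3.8 (pp. 61–62)] -/
theorem triangle_gadget (hop : o ≠ p) (hoq : o ≠ q) (hpq : p ≠ q) (hES : ES = {s(o, p), s(o, q), s(p, q)})
    (h₁ : ∀ e ∈ E₁, ∀ z ∈ e, z ∈ V₁) (h₂ : ∀ e ∈ E₂, ∀ z ∈ e, z ∈ V₂) (hS : V₁ ∩ V₂ ⊆ {o, p, q})
    (hd : Disjoint E₁ E₂) (hd₁ : Disjoint ES E₁) (hd₂ : Disjoint ES E₂) {X Y : BondConfig V}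
    (hX : IsForestCfg X) (hY : IsForestCfg Y) (hcover : ∀ g ∈ ES, g ∈ X ∨ g ∈ Y)
    (hnw : ¬ ∀ x ∈ ({o, p, q} : Set V), ∀ y' ∈ ({o, p, q} : Set V), (openGraph (X ∩ E₂)).Reachable x y' → x = y') :
    (∀ x ∈ ({o, p, q} : Set V), ∀ y' ∈ ({o, p, q} : Set V), (openGraph (X ∩ E₁)).Reachable x y' → x = y') ∧
    (∀ x ∈ ({o, p, q} : Set V), ∀ y' ∈ ({o, p, q} : Set V), (openGraph (Y ∩ E₁)).Reachable x y' → x = y') ∧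
    (∀ x ∈ ({o, p, q} : Set V), ∀ y' ∈ ({o, p, q} : Set V), (openGraph (Y ∩ E₂)).Reachable x y' → x = y') := by
  obtain ⟨hpoq, hqop, hoqp, hpqo⟩ := triple_perm o p q
  -- the gadget pairs and where they are not
  have hg₁ : s(o, p) ∈ ES := by rw [hES]; exact mem_insert _ _
  have hg₂ : s(o, q) ∈ ES := by rw [hES]; exact mem_insert_of_mem _ (mem_insert _ _)
  have hg₃ : s(p, q) ∈ ES := by rw [hES]; exact mem_insert_of_mem _ (mem_insert_of_mem _ rfl)
  have hn₁ : ∀ g ∈ ES, g ∉ E₁ := fun g hg h => Set.disjoint_left.1 hd₁ hg h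
  have hn₂ : ∀ g ∈ ES, g ∉ E₂ := fun g hg h => Set.disjoint_left.1 hd₂ hg h
  have hpo : s(p, o) ∈ ES := by rw [Sym2.eq_swap]; exact hg₁
  have hqo : s(q, o) ∈ ES := by rw [Sym2.eq_swap]; exact hg₂
  have hqp : s(q, p) ∈ ES := by rw [Sym2.eq_swap]; exact hg₃
  -- two gadget pairs in a forest wire both its sides
  have W2 : ∀ {Z : BondConfig V} {a b c : V}, a ≠ b → a ≠ c → b ≠ c → ({a, b, c} : Set V) = {o, p, q} → IsForestCfg Z →
      s(a, b) ∈ ES → s(a, c) ∈ ES → s(a, b) ∈ Z → s(a, c) ∈ Z →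
      (∀ x ∈ ({o, p, q} : Set V), ∀ y' ∈ ({o, p, q} : Set V), (openGraph (Z ∩ E₁)).Reachable x y' → x = y') ∧
      (∀ x ∈ ({o, p, q} : Set V), ∀ y' ∈ ({o, p, q} : Set V), (openGraph (Z ∩ E₂)).Reachable x y' → x = y') := by
    intro Z a b c hab hac hbc habc hZ hgab hgac hab' hac'
    rw [← habc]
    exact ⟨sep_inter_of_two_pairs hab hac hbc hZ hab' hac' (hn₁ _ hgab) (hn₁ _ hgac),
      sep_inter_of_two_pairs hab hac hbc hZ hab' hac' (hn₂ _ hgab) (hn₂ _ hgac)⟩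
  -- one gadget pair in a forest wires one of its sides
  have W1 : ∀ {Z : BondConfig V} {a b c : V}, a ≠ b → a ≠ c → b ≠ c → ({a, b, c} : Set V) = {o, p, q} → IsForestCfg Z →
      s(a, b) ∈ ES → s(a, c) ∈ ES → s(a, b) ∈ Z →
      (∀ x ∈ ({o, p, q} : Set V), ∀ y' ∈ ({o, p, q} : Set V), (openGraph (Z ∩ E₁)).Reachable x y' → x = y') ∨
      (∀ x ∈ ({o, p, q} : Set V), ∀ y' ∈ ({o, p, q} : Set V), (openGraph (Z ∩ E₂)).Reachable x y' → x = y') := by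
    intro Z a b c hab hac hbc habc hZ hgab hgac hab'
    rw [← habc]
    have htouch : ∀ e ∈ Z ∩ E₁, ∀ z ∈ e, z ∈ V₂ → z ∈ ({a, b, c} : Set V) := by
      intro e he z hz hzV
      rw [habc]; exact hS ⟨h₁ e he.2 z hz, hzV⟩
    have hsub : insert s(a, b) (Z ∩ E₁) ∪ Z ∩ E₂ ⊆ Z :=
      union_subset (insert_subset hab' inter_subset_left) inter_subset_left
    exact sep_or_sep_of_isForestCfg hab hac hbc htouch (fun e he z hz => h₂ e he.2 z hz) (fun h => hn₁ _ hgab h.2)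
      (Set.disjoint_of_subset inter_subset_right inter_subset_right hd) (fun h => hn₂ _ hgab h.2)
      (fun h => hn₂ _ hgac h.2) (isForestCfg_of_subset hZ hsub)
  -- `X` holds at most one gadget pair
  have hX12 : ¬ (s(o, p) ∈ X ∧ s(o, q) ∈ X) := fun h => hnw (W2 hop hoq hpq rfl hX hg₁ hg₂ h.1 h.2).2
  have hX13 : ¬ (s(o, p) ∈ X ∧ s(p, q) ∈ X) := fun h =>
    hnw (W2 hop.symm hpq hoq hpoq hX hpo hg₃ (by rw [Sym2.eq_swap]; exact h.1) h.2).2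
  have hX23 : ¬ (s(o, q) ∈ X ∧ s(p, q) ∈ X) := fun h =>
    hnw (W2 hoq.symm hpq.symm hop hqop hX hqo hqp (by rw [Sym2.eq_swap]; exact h.1) (by rw [Sym2.eq_swap]; exact h.2)).2
  by_cases hx₁ : s(o, p) ∈ X
  · have hy₂ : s(o, q) ∈ Y := (hcover _ hg₂).resolve_left fun h => hX12 ⟨hx₁, h⟩
    have hy₃ : s(p, q) ∈ Y := (hcover _ hg₃).resolve_left fun h => hX13 ⟨hx₁, h⟩
    obtain ⟨hY1, hY2⟩ := W2 hoq.symm hpq.symm hop hqop hY hqo hqp (by rw [Sym2.eq_swap]; exact hy₂)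
      (by rw [Sym2.eq_swap]; exact hy₃)
    exact ⟨(W1 hop hoq hpq rfl hX hg₁ hg₂ hx₁).resolve_right hnw, hY1, hY2⟩
  by_cases hx₂ : s(o, q) ∈ X
  · have hy₁ : s(o, p) ∈ Y := (hcover _ hg₁).resolve_left hx₁
    have hy₃ : s(p, q) ∈ Y := (hcover _ hg₃).resolve_left fun h => hX23 ⟨hx₂, h⟩
    obtain ⟨hY1, hY2⟩ := W2 hop.symm hpq hoq hpoq hY hpo hg₃ (by rw [Sym2.eq_swap]; exact hy₁) hy₃
    exact ⟨(W1 hoq hop hpq.symm hoqp hX hg₂ hg₁ hx₂).resolve_right hnw, hY1, hY2⟩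
  by_cases hx₃ : s(p, q) ∈ X
  · have hy₁ : s(o, p) ∈ Y := (hcover _ hg₁).resolve_left hx₁
    have hy₂ : s(o, q) ∈ Y := (hcover _ hg₂).resolve_left hx₂
    obtain ⟨hY1, hY2⟩ := W2 hop hoq hpq rfl hY hg₁ hg₂ hy₁ hy₂
    exact ⟨(W1 hpq hop.symm hoq.symm hpqo hX hg₃ hpo hx₃).resolve_right hnw, hY1, hY2⟩
  · -- no gadget pair in `X`: `Y` holds the whole triangle
    have hy₁ : s(o, p) ∈ Y := (hcover _ hg₁).resolve_left hx₁
    have hy₂ : s(o, q) ∈ Y := (hcover _ hg₂).resolve_left hx₂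
    have hy₃ : s(p, q) ∈ Y := (hcover _ hg₃).resolve_left hx₃
    have hsub : ({s(o, p), s(o, q)} : Set (Sym2 V)) ∪ {s(p, q)} ⊆ Y := by
      refine union_subset ?_ (singleton_subset_iff.2 hy₃)
      intro g hg
      rcases mem_insert_iff.1 hg with rfl | hg
      · exact hy₁
      · rw [mem_singleton_iff.1 hg]; exact hy₂
    exact absurd (isForestCfg_of_subset hY hsub) (not_isForestCfg_triangle hop hoq hpq)

/-- **The transfer step across a triangle separator** (memo §2f(v), `|S| = 3`).  On a fibre `(M', u₀)` with pairs in `ES ∪ E₁ ∪ E₂`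
containing the triangle `ES`, let `N₀ = M' ∩ E₂`, `N₁ = M' ∩ (ES ∪ E₂)`; `Φ ω = ω ∆ N₀` if both `ω ∩ E₂` and `(ω ∆ M') ∩ E₂` are
`S`-wired (join no two points of `S`), `Φ ω = ω ∆ N₁` otherwise.  Then `Φ` maps valid colourings to valid colourings of the same fibre,
is an involution, keeps side 1 and flips the free pairs of side 2. [cite: Grimmett2006, §3.8 (pp. 61–62)] [cite: Linusson2011, Prop. 2.6] -/
theorem forest_pair_transfer_of_triangleSep (hop : o ≠ p) (hoq : o ≠ q) (hpq : p ≠ q) (hES : ES = {s(o, p), s(o, q), s(p, q)})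
    (h₁ : ∀ e ∈ E₁, ∀ z ∈ e, z ∈ V₁) (h₂ : ∀ e ∈ E₂, ∀ z ∈ e, z ∈ V₂) (hS : V₁ ∩ V₂ ⊆ {o, p, q})
    (hd : Disjoint E₁ E₂) (hd₁ : Disjoint ES E₁) (hd₂ : Disjoint ES E₂) {M' : BondConfig V}
    (hM' : M' ∪ u₀ ⊆ ES ∪ (E₁ ∪ E₂)) (hdense : ES ⊆ M' ∪ u₀)
    (Φ : BondConfig V → BondConfig V)
    (hΦ : ∀ ω, Φ ω = if (∀ x ∈ ({o, p, q} : Set V), ∀ y' ∈ ({o, p, q} : Set V), (openGraph (ω ∩ E₂)).Reachable x y' → x = y') ∧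
        (∀ x ∈ ({o, p, q} : Set V), ∀ y' ∈ ({o, p, q} : Set V), (openGraph ((ω ∆ M') ∩ E₂)).Reachable x y' → x = y')
      then ω ∆ (M' ∩ E₂) else ω ∆ (M' ∩ (ES ∪ E₂)))
    {ω : BondConfig V} (hω : ω \ M' = u₀) (hF : IsForestCfg ω) (hFB : IsForestCfg (ω ∆ M')) :
    Φ ω \ M' = u₀ ∧ IsForestCfg (Φ ω) ∧ IsForestCfg ((Φ ω) ∆ M') ∧ Φ (Φ ω) = ω ∧
      (∀ x ∈ E₁, x ∈ Φ ω ↔ x ∈ ω) ∧ (∀ x ∈ M', x ∈ E₂ → (x ∈ Φ ω ↔ x ∉ ω)) := by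
  set N₀ : BondConfig V := M' ∩ E₂ with hN₀
  set N₁ : BondConfig V := M' ∩ (ES ∪ E₂) with hN₁
  have hg₁ : s(o, p) ∈ ES := by rw [hES]; exact mem_insert _ _
  have hg₂ : s(o, q) ∈ ES := by rw [hES]; exact mem_insert_of_mem _ (mem_insert _ _)
  have hn₁ : ∀ g ∈ ES, g ∉ E₁ := fun g hg h => Set.disjoint_left.1 hd₁ hg h
  have hn₂ : ∀ g ∈ ES, g ∉ E₂ := fun g hg h => Set.disjoint_left.1 hd₂ hg h
  have hE : ∀ x, x ∈ E₁ → x ∉ E₂ := fun x hx1 hx2 => Set.disjoint_left.1 hd hx1 hx2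
  have hESv : ∀ e ∈ ES, ∀ z ∈ e, z ∈ ({o, p, q} : Set V) := by
    intro e he z hz
    rw [hES] at he
    simp only [mem_insert_iff, mem_singleton_iff] at he ⊢
    rcases he with rfl | rfl | rfl <;> rcases Sym2.mem_iff.1 hz with rfl | rfl <;> simp
  -- where the configurations live
  have hωsub : ω ⊆ ES ∪ (E₁ ∪ E₂) := fun x hx => by
    by_cases hxM : x ∈ M'
    · exact hM' (Or.inl hxM)
    · exact hM' (Or.inr (hω ▸ ⟨hx, hxM⟩))
  have hM'sub : M' ⊆ ES ∪ (E₁ ∪ E₂) := fun x hx => hM' (Or.inl hx)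
  have hsd : ∀ {X N : BondConfig V}, X ⊆ ES ∪ (E₁ ∪ E₂) → N ⊆ M' → X ∆ N ⊆ ES ∪ (E₁ ∪ E₂) := by
    intro X N hX hN x hx
    rw [Set.mem_symmDiff] at hx
    rcases hx with ⟨hx, -⟩ | ⟨hx, -⟩
    · exact hX hx
    · exact hM'sub (hN hx)
  -- splitting a configuration into (gadget + one side) and (other side)
  have split₂ : ∀ {X : BondConfig V}, X ⊆ ES ∪ (E₁ ∪ E₂) → X ∩ (ES ∪ E₁) ∪ X ∩ E₂ = X := fun hX => by
    rw [← inter_union_distrib_left, union_assoc]; exact inter_eq_self_of_subset_left hX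
  have split₁ : ∀ {X : BondConfig V}, X ⊆ ES ∪ (E₁ ∪ E₂) → X ∩ (ES ∪ E₂) ∪ X ∩ E₁ = X := fun hX => by
    rw [← inter_union_distrib_left, union_assoc, union_comm E₂ E₁]; exact inter_eq_self_of_subset_left hX
  have touch₂ : ∀ (X : BondConfig V), ∀ e ∈ X ∩ (ES ∪ E₁), ∀ z ∈ e, z ∈ V₂ → z ∈ ({o, p, q} : Set V) := by
    rintro X e ⟨-, he | he⟩ z hz hzV
    · exact hESv e he z hz
    · exact hS ⟨h₁ e he z hz, hzV⟩
  have touch₁ : ∀ (X : BondConfig V), ∀ e ∈ X ∩ (ES ∪ E₂), ∀ z ∈ e, z ∈ V₁ → z ∈ ({o, p, q} : Set V) := by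
    rintro X e ⟨-, he | he⟩ z hz hzV
    · exact hESv e he z hz
    · exact hS ⟨hzV, h₂ e he z hz⟩
  have on₂ : ∀ (X : BondConfig V), ∀ e ∈ X ∩ E₂, ∀ z ∈ e, z ∈ V₂ := fun X e he z hz => h₂ e he.2 z hz
  have on₁ : ∀ (X : BondConfig V), ∀ e ∈ X ∩ E₁, ∀ z ∈ e, z ∈ V₁ := fun X e he z hz => h₁ e he.2 z hz
  have disj₂ : ∀ (X Y : BondConfig V), Disjoint (X ∩ (ES ∪ E₁)) (Y ∩ E₂) := by
    intro X Y
    refine Set.disjoint_left.2 ?_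
    rintro x ⟨-, hx | hx⟩ ⟨-, hx2⟩
    · exact hn₂ x hx hx2
    · exact hE x hx hx2
  have disj₁ : ∀ (X Y : BondConfig V), Disjoint (X ∩ (ES ∪ E₂)) (Y ∩ E₁) := by
    intro X Y
    refine Set.disjoint_left.2 ?_
    rintro x ⟨-, hx | hx⟩ ⟨-, hx1⟩
    · exact hn₁ x hx hx1
    · exact hE x hx1 hx
  -- gluing: a wired side-2 part onto (gadget + side 1), and a wired side-1 part onto (gadget + side 2)
  have glue₂ : ∀ {X Y : BondConfig V}, IsForestCfg X → IsForestCfg Y →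
      (∀ x ∈ ({o, p, q} : Set V), ∀ y' ∈ ({o, p, q} : Set V), (openGraph (Y ∩ E₂)).Reachable x y' → x = y') →
      IsForestCfg (X ∩ (ES ∪ E₁) ∪ Y ∩ E₂) := by
    intro X Y hX hY hsep
    exact isForestCfg_union_of_sep hop hoq hpq (touch₂ X) (on₂ Y) (disj₂ X Y) (fun h => hn₂ _ hg₁ h.2)
      (fun h => hn₂ _ hg₂ h.2) (isForestCfg_of_subset hX inter_subset_left) (isForestCfg_of_subset hY inter_subset_left) hsep
  have glue₁ : ∀ {X Y : BondConfig V}, IsForestCfg X → IsForestCfg Y →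
      (∀ x ∈ ({o, p, q} : Set V), ∀ y' ∈ ({o, p, q} : Set V), (openGraph (Y ∩ E₁)).Reachable x y' → x = y') →
      IsForestCfg (X ∩ (ES ∪ E₂) ∪ Y ∩ E₁) := by
    intro X Y hX hY hsep
    exact isForestCfg_union_of_sep hop hoq hpq (touch₁ X) (on₁ Y) (disj₁ X Y) (fun h => hn₁ _ hg₁ h.2)
      (fun h => hn₁ _ hg₂ h.2) (isForestCfg_of_subset hX inter_subset_left) (isForestCfg_of_subset hY inter_subset_left) hsep
  -- the two recolouring sets
  have hN₀M : N₀ ⊆ M' := inter_subset_left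
  have hN₁M : N₁ ⊆ M' := inter_subset_left
  have hN₀out : ∀ x ∈ N₀, x ∉ ES ∪ E₁ := by
    rintro x ⟨-, hx2⟩ (hx | hx)
    · exact hn₂ x hx hx2
    · exact hE x hx hx2
  have hN₁out : ∀ x ∈ N₁, x ∉ E₁ := by
    rintro x ⟨-, hx | hx⟩ hx1
    · exact hn₁ x hx hx1
    · exact hE x hx1 hx
  have hMN₀ : ∀ x ∈ M', x ∈ E₂ → x ∈ N₀ := fun x hx hx2 => ⟨hx, hx2⟩
  have hMN₁ : ∀ x ∈ M', x ∈ ES ∪ E₂ → x ∈ N₁ := fun x hx hx2 => ⟨hx, hx2⟩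
  have hMN₁' : ∀ x ∈ M', x ∈ E₂ → x ∈ N₁ := fun x hx hx2 => ⟨hx, Or.inr hx2⟩
  have hN₀E₁ : ∀ x ∈ N₀, x ∉ E₁ := fun x hx hx1 => hN₀out x hx (Or.inr hx1)
  -- every gadget pair is in one of the two classes
  have hcover : ∀ g ∈ ES, g ∈ ω ∨ g ∈ ω ∆ M' := by
    intro g hg
    rcases hdense hg with hgM | hgu
    · by_cases hgω : g ∈ ω
      · exact Or.inl hgω
      · exact Or.inr (Set.mem_symmDiff.2 (Or.inr ⟨hgM, hgω⟩))
    · exact Or.inl (hω ▸ hgu).1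
  have hcover' : ∀ g ∈ ES, g ∈ ω ∆ M' ∨ g ∈ ω := fun g hg => (hcover g hg).symm
  by_cases hQ : (∀ x ∈ ({o, p, q} : Set V), ∀ y' ∈ ({o, p, q} : Set V), (openGraph (ω ∩ E₂)).Reachable x y' → x = y') ∧
      (∀ x ∈ ({o, p, q} : Set V), ∀ y' ∈ ({o, p, q} : Set V), (openGraph ((ω ∆ M') ∩ E₂)).Reachable x y' → x = y')
  · -- both side-2 classes wired: recolour side 2 only
    have hΦω : Φ ω = ω ∆ N₀ := by rw [hΦ ω, if_pos hQ]
    have hT1 : (ω ∆ N₀) ∩ (ES ∪ E₁) = ω ∩ (ES ∪ E₁) := symmDiff_inter_eq_of_disjoint hN₀out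
    have hT2 : (ω ∆ N₀) ∩ E₂ = (ω ∆ M') ∩ E₂ := symmDiff_inter_eq_partner hN₀M hMN₀
    have hT3 : ((ω ∆ N₀) ∆ M') ∩ (ES ∪ E₁) = (ω ∆ M') ∩ (ES ∪ E₁) := symmDiff_symmDiff_inter_eq_partner hN₀M hN₀out
    have hT4 : ((ω ∆ N₀) ∆ M') ∩ E₂ = ω ∩ E₂ := symmDiff_symmDiff_inter_eq_self hN₀M hMN₀
    have hval₁ : IsForestCfg (ω ∆ N₀) := by
      rw [← split₂ (hsd hωsub hN₀M), hT1, hT2]; exact glue₂ hF hFB hQ.2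
    have hval₂ : IsForestCfg ((ω ∆ N₀) ∆ M') := by
      rw [← split₂ (hsd (hsd hωsub hN₀M) subset_rfl), hT3, hT4]; exact glue₂ hFB hF hQ.1
    have hQ' : (∀ x ∈ ({o, p, q} : Set V), ∀ y' ∈ ({o, p, q} : Set V), (openGraph ((ω ∆ N₀) ∩ E₂)).Reachable x y' → x = y') ∧
        (∀ x ∈ ({o, p, q} : Set V), ∀ y' ∈ ({o, p, q} : Set V),
          (openGraph (((ω ∆ N₀) ∆ M') ∩ E₂)).Reachable x y' → x = y') := by
      rw [hT2, hT4]; exact ⟨hQ.2, hQ.1⟩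
    refine ⟨by rw [hΦω, symmDiff_sdiff_eq_of_subset hN₀M, hω], hΦω ▸ hval₁, hΦω ▸ hval₂, ?_,
      fun x hx => by rw [hΦω]; exact mem_symmDiff_iff_of_notMem (fun h => hN₀E₁ x h hx),
      fun x hxM hx2 => by rw [hΦω]; exact mem_symmDiff_iff_of_mem (hMN₀ x hxM hx2)⟩
    rw [hΦω, hΦ (ω ∆ N₀), if_pos hQ']
    exact symmDiff_symmDiff_cancel_right _ _
  · -- a side-2 class is not wired: recolour side 2 AND the gadget; both side-1 classes are wired (gadget lemma)
    have hΦω : Φ ω = ω ∆ N₁ := by rw [hΦ ω, if_neg hQ]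
    have hsep₁ : (∀ x ∈ ({o, p, q} : Set V), ∀ y' ∈ ({o, p, q} : Set V), (openGraph (ω ∩ E₁)).Reachable x y' → x = y') ∧
        (∀ x ∈ ({o, p, q} : Set V), ∀ y' ∈ ({o, p, q} : Set V), (openGraph ((ω ∆ M') ∩ E₁)).Reachable x y' → x = y') := by
      rw [not_and_or] at hQ
      rcases hQ with hnw | hnw
      · obtain ⟨hA, hB, -⟩ := triangle_gadget hop hoq hpq hES h₁ h₂ hS hd hd₁ hd₂ hF hFB hcover hnw
        exact ⟨hA, hB⟩
      · obtain ⟨hB, hA, -⟩ := triangle_gadget hop hoq hpq hES h₁ h₂ hS hd hd₁ hd₂ hFB hF hcover' hnw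
        exact ⟨hA, hB⟩
    have hT1 : (ω ∆ N₁) ∩ E₁ = ω ∩ E₁ := symmDiff_inter_eq_of_disjoint hN₁out
    have hT2 : (ω ∆ N₁) ∩ (ES ∪ E₂) = (ω ∆ M') ∩ (ES ∪ E₂) := symmDiff_inter_eq_partner hN₁M hMN₁
    have hT2' : (ω ∆ N₁) ∩ E₂ = (ω ∆ M') ∩ E₂ := symmDiff_inter_eq_partner hN₁M hMN₁'
    have hT3 : ((ω ∆ N₁) ∆ M') ∩ E₁ = (ω ∆ M') ∩ E₁ := symmDiff_symmDiff_inter_eq_partner hN₁M hN₁out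
    have hT4 : ((ω ∆ N₁) ∆ M') ∩ (ES ∪ E₂) = ω ∩ (ES ∪ E₂) := symmDiff_symmDiff_inter_eq_self hN₁M hMN₁
    have hT4' : ((ω ∆ N₁) ∆ M') ∩ E₂ = ω ∩ E₂ := symmDiff_symmDiff_inter_eq_self hN₁M hMN₁'
    have hval₁ : IsForestCfg (ω ∆ N₁) := by
      rw [← split₁ (hsd hωsub hN₁M), hT1, hT2]; exact glue₁ hFB hF hsep₁.1
    have hval₂ : IsForestCfg ((ω ∆ N₁) ∆ M') := by
      rw [← split₁ (hsd (hsd hωsub hN₁M) subset_rfl), hT3, hT4]; exact glue₁ hF hFB hsep₁.2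
    have hQ' : ¬ ((∀ x ∈ ({o, p, q} : Set V), ∀ y' ∈ ({o, p, q} : Set V), (openGraph ((ω ∆ N₁) ∩ E₂)).Reachable x y' → x = y') ∧
        (∀ x ∈ ({o, p, q} : Set V), ∀ y' ∈ ({o, p, q} : Set V),
          (openGraph (((ω ∆ N₁) ∆ M') ∩ E₂)).Reachable x y' → x = y')) := by
      rw [hT2', hT4', and_comm]; exact hQ
    refine ⟨by rw [hΦω, symmDiff_sdiff_eq_of_subset hN₁M, hω], hΦω ▸ hval₁, hΦω ▸ hval₂, ?_,
      fun x hx => by rw [hΦω]; exact mem_symmDiff_iff_of_notMem (fun h => hN₁out x h hx),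
      fun x hxM hx2 => by rw [hΦω]; exact mem_symmDiff_iff_of_mem (hMN₁' x hxM hx2)⟩
    rw [hΦω, hΦ (ω ∆ N₁), if_neg hQ']
    exact symmDiff_symmDiff_cancel_right _ _

/-- **The node's inequality is an EQUALITY across a triangle separator.**  Fibre `(M ∪ {e, f}, u₀)`, `e = ov ∈ E₁`, `f = oy ∈ E₂`,
the pairs of `Eᵢ` on `Vᵢ`, `V₁ ∩ V₂ ⊆ S = {o, p, q}` (a triangle through `o`, pairwise distinct), `ES = {op, oq, pq}`, the three sets
`ES, E₁, E₂` pairwise disjoint, all pairs of the fibre in `ES ∪ E₁ ∪ E₂` and the whole triangle AMONG them (`ES ⊆ M ∪ {e, f} ∪ u₀`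
— density `|E(S)| ≥ 2|S| - 3 = 3`): `#(Fo ∩ {e, f ∈ ω}, Fo) = #(Fo ∩ {e ∈ ω}, Fo ∩ {f ∈ ω})`, i.e. `P(e, f same colour) = 1/2`
exactly.  The case `|S| = 3` of the dense-separator equality (memo bschramm/FROM-fk-1-g19-ADVERSARIAL.md §2f), the mechanism of the
primitive equalities at 9, 10 and 12 vertices. [cite: SempleWelsh2008, Conj. 1.1 (p. 2)] [cite: Linusson2011, Prop. 2.6]
[cite: Grimmett2006, §3.8 (pp. 61–62)] -/
theorem adjForestNoSq_fibre_eq_of_triangleSep (hop : o ≠ p) (hoq : o ≠ q) (hpq : p ≠ q)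
    (hES : ES = {s(o, p), s(o, q), s(p, q)})
    (h₁ : ∀ e ∈ E₁, ∀ z ∈ e, z ∈ V₁) (h₂ : ∀ e ∈ E₂, ∀ z ∈ e, z ∈ V₂) (hS : V₁ ∩ V₂ ⊆ {o, p, q})
    (hd : Disjoint E₁ E₂) (hd₁ : Disjoint ES E₁) (hd₂ : Disjoint ES E₂) (heE : s(o, v) ∈ E₁) (hfE : s(o, y) ∈ E₂)
    (hsub : insert s(o, y) (insert s(o, v) M) ∪ u₀ ⊆ ES ∪ (E₁ ∪ E₂))
    (hdense : ES ⊆ insert s(o, y) (insert s(o, v) M) ∪ u₀) :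
    fibreCount (insert s(o, y) (insert s(o, v) M)) u₀ (forestEv V ∩ {ω | s(o, v) ∈ ω ∧ s(o, y) ∈ ω}) (forestEv V) =
      fibreCount (insert s(o, y) (insert s(o, v) M)) u₀ (forestEv V ∩ {ω | s(o, v) ∈ ω}) (forestEv V ∩ {ω | s(o, y) ∈ ω}) := by
  set M' : BondConfig V := insert s(o, y) (insert s(o, v) M) with hM'
  set Φ : BondConfig V → BondConfig V := fun ω =>
    if (∀ x ∈ ({o, p, q} : Set V), ∀ y' ∈ ({o, p, q} : Set V), (openGraph (ω ∩ E₂)).Reachable x y' → x = y') ∧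
        (∀ x ∈ ({o, p, q} : Set V), ∀ y' ∈ ({o, p, q} : Set V), (openGraph ((ω ∆ M') ∩ E₂)).Reachable x y' → x = y')
      then ω ∆ (M' ∩ E₂) else ω ∆ (M' ∩ (ES ∪ E₂)) with hΦdef
  have hΦ : ∀ ω, Φ ω =
      if (∀ x ∈ ({o, p, q} : Set V), ∀ y' ∈ ({o, p, q} : Set V), (openGraph (ω ∩ E₂)).Reachable x y' → x = y') ∧
        (∀ x ∈ ({o, p, q} : Set V), ∀ y' ∈ ({o, p, q} : Set V), (openGraph ((ω ∆ M') ∩ E₂)).Reachable x y' → x = y')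
      then ω ∆ (M' ∩ E₂) else ω ∆ (M' ∩ (ES ∪ E₂)) := fun ω => rfl
  have hfM : s(o, y) ∈ M' := mem_insert _ _
  have hfB : ∀ X : BondConfig V, s(o, y) ∈ X ∆ M' ↔ s(o, y) ∉ X := fun X => mem_symmDiff_iff_of_mem hfM
  refine fibreCount_eq_of_bij Φ Φ (fun ω hω hA hB => ?_) (fun ω hω hA hB => ?_)
  · -- bad ↦ good
    obtain ⟨hF, he, hf⟩ := hA
    have hF' : IsForestCfg ω := hF
    have hFB : IsForestCfg (ω ∆ M') := hB
    obtain ⟨hfib, hF1, hF2, hinv, hE1, hE2⟩ :=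
      forest_pair_transfer_of_triangleSep hop hoq hpq hES h₁ h₂ hS hd hd₁ hd₂ hsub hdense Φ hΦ hω hF' hFB
    refine ⟨hfib, ⟨hF1, (hE1 _ heE).2 he⟩, ⟨hF2, ?_⟩, hinv⟩
    show s(o, y) ∈ (Φ ω) ∆ M'
    rw [hfB, hE2 _ hfM hfE, not_not]; exact hf
  · -- good ↦ bad
    obtain ⟨hF, he⟩ := hA
    obtain ⟨hFB, hf⟩ := hB
    have hF' : IsForestCfg ω := hF
    have hFB' : IsForestCfg (ω ∆ M') := hFB
    obtain ⟨hfib, hF1, hF2, hinv, hE1, hE2⟩ :=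
      forest_pair_transfer_of_triangleSep hop hoq hpq hES h₁ h₂ hS hd hd₁ hd₂ hsub hdense Φ hΦ hω hF' hFB'
    have hfω : s(o, y) ∉ ω := (hfB ω).1 hf
    exact ⟨hfib, ⟨hF1, (hE1 _ heE).2 he, (hE2 _ hfM hfE).2 hfω⟩, hF2, hinv⟩

end TriangleSep

end FK

end Summit.CriticalPhenomena.PercolationContinuityZ3.Theorems

end
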